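import Summits.HubbardSuperconductivity.HubbardSuperconductivity.Theorems.AnisotropyChordStiffnessFilteredLocality
import Mathlib.Analysis.SpecialFunctions.ImproperIntegrals

/-!
# Route `AnisotropyChord` / H0 rotor rung: THEOREM TWIST-IR — the GENERAL FILTERED SPECTRAL IDENTITY and the
# LORENTZIAN CUTOFF PAIR (stub (S2′); theory seat memo ROTOR-THEORY-8 §116, Sketch8 Part L ported)

Referee pass on §107 by the theory seat `hubbard-h0-rotor-theory-1` (cycle 8):

* `filteredSpectral_identity` — for ANY integrable `w` with `g(ω) = ∫ w(t)e^{itω}dt`: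
  `Σᵢ (g(λᵢ−E₀) aᵢ − g(E₀−λᵢ) bᵢ) = ∫ w(t)⟨ψ,[A,τ_t(B)]ψ⟩dt` (no support / sector hypothesis; L1 =
  `filteredLocality_identity` is the special case `g|(−∞,0] = 0`); `filteredSpectral_identity_odd`;
* the Lorentzian pair `lorentzWeight Ω t = −(i/2)·sgn(t)·e^{−Ω|t|}`, `lorentzFilter Ω ω = ω/(ω²+Ω²)`, the low weight
  `lorentzLow Ω ω = Ω²/(ω(ω²+Ω²))` with `1/ω = g_Ω + ℓ_Ω`, `ℓ_Ω ω² ≤ Ω/2`, `integrable_lorentzWeight`;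
* **`lorentzFilterFT_holds : LorentzFilterFT`** — `∫ w_Ω(t) e^{itω} dt = ω/(ω²+Ω²)` (Mathlib
  `integral_exp_mul_complex_Ioi/Iic`).  Stub (S2) of the S-TWIST skeleton (memo §109) in its final form.
-/

set_option linter.dupNamespace false

noncomputable section

open Matrix Complex Finset MeasureTheory
open scoped ComplexConjugate
open Literature.MathematicalPhysics.QuantumLattice

namespace Summit.HubbardSuperconductivity.HubbardSuperconductivity.Theorems.AnisotropyChord.Stiffness

/-- Integrability of `t ↦ w(t) e^{-itc}` for integrable `w`. [folklore] -/
theorem integrable_mul_cexp_neg {w : ℝ → ℂ} (hw : Integrable w) (c : ℝ) :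
    Integrable fun t : ℝ => w t * cexp (-((t * c : ℝ) : ℂ) * I) := by
  have h := integrable_mul_cexp hw (-c)
  refine h.congr (Filter.Eventually.of_forall fun t => ?_)
  show w t * cexp (((t * -c : ℝ) : ℂ) * I) = w t * cexp (-((t * c : ℝ) : ℂ) * I)
  congr 2; push_cast; ring

open Literature.MathematicalPhysics.QuantumLattice MeasureTheory

/-- **General filtered spectral identity** (both branches; any `w ∈ L¹`). [cite: HastingsKomaCMP2006, §3] -/
theorem filteredSpectral_identity {n : Type*} [Fintype n] [DecidableEq n] (H : Matrix n n ℂ) (hH : H.IsHermitian)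
    (A B : Matrix n n ℂ) (ψ : n → ℂ) (E₀ : ℝ) (hψ : H *ᵥ ψ = (E₀ : ℂ) • ψ)
    (w : ℝ → ℂ) (hw : Integrable w) (g : ℝ → ℂ)
    (hg : ∀ ω : ℝ, g ω = ∫ t : ℝ, w t * cexp (((t * ω : ℝ) : ℂ) * I)) :
    ∑ i, (g (hH.eigenvalues i - E₀) *
            ((star ψ ⬝ᵥ (A *ᵥ ⇑(hH.eigenvectorBasis i))) *
              (star (⇑(hH.eigenvectorBasis i)) ⬝ᵥ (B *ᵥ ψ))) -
          g (E₀ - hH.eigenvalues i) *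
            ((star ψ ⬝ᵥ (B *ᵥ ⇑(hH.eigenvectorBasis i))) *
              (star (⇑(hH.eigenvectorBasis i)) ⬝ᵥ (A *ᵥ ψ))))
      = ∫ t : ℝ, w t *
          (star ψ ⬝ᵥ ((A * heisenbergEvolution H t B - heisenbergEvolution H t B * A) *ᵥ ψ)) := by
  have hint : ∀ t : ℝ,
      w t * (star ψ ⬝ᵥ ((A * heisenbergEvolution H t B - heisenbergEvolution H t B * A) *ᵥ ψ)) =
        ∑ i, ((star ψ ⬝ᵥ (A *ᵥ ⇑(hH.eigenvectorBasis i))) *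
                (star (⇑(hH.eigenvectorBasis i)) ⬝ᵥ (B *ᵥ ψ)) *
                (w t * cexp (((t * (hH.eigenvalues i - E₀) : ℝ) : ℂ) * I)) -
              (star ψ ⬝ᵥ (B *ᵥ ⇑(hH.eigenvectorBasis i))) *
                (star (⇑(hH.eigenvectorBasis i)) ⬝ᵥ (A *ᵥ ψ)) *
                (w t * cexp (-((t * (hH.eigenvalues i - E₀) : ℝ) : ℂ) * I))) := by
    intro t
    rw [commutator_expect_eq_sum hH A B hψ t, Finset.mul_sum]
    refine Finset.sum_congr rfl fun i _ => ?_
    ring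
  symm
  simp_rw [hint]
  rw [integral_finsetSum]
  swap
  · intro i _
    exact ((integrable_mul_cexp hw _).const_mul _).sub ((integrable_mul_cexp_neg hw _).const_mul _)
  refine Finset.sum_congr rfl fun i _ => ?_
  rw [integral_sub ((integrable_mul_cexp hw _).const_mul _) ((integrable_mul_cexp_neg hw _).const_mul _),
    integral_const_mul, integral_const_mul, ← hg (hH.eigenvalues i - E₀)]
  have hneg : ∫ t : ℝ, w t * cexp (-((t * (hH.eigenvalues i - E₀) : ℝ) : ℂ) * I) =
      g (E₀ - hH.eigenvalues i) := by
    rw [hg]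
    refine integral_congr_ae (Filter.Eventually.of_forall fun t => ?_)
    show w t * cexp (-((t * (hH.eigenvalues i - E₀) : ℝ) : ℂ) * I) =
      w t * cexp (((t * (E₀ - hH.eigenvalues i) : ℝ) : ℂ) * I)
    congr 2; push_cast; ring
  rw [hneg]; ring

/-- Symmetrised (odd-filter) form: if `g` is odd, `Σᵢ g(λᵢ−E₀)(aᵢ + bᵢ) = ∫ w ⟨ψ,[A,τ_t B]ψ⟩`. [cite: HastingsKomaCMP2006, §3] -/
theorem filteredSpectral_identity_odd {n : Type*} [Fintype n] [DecidableEq n] (H : Matrix n n ℂ) (hH : H.IsHermitian)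
    (A B : Matrix n n ℂ) (ψ : n → ℂ) (E₀ : ℝ) (hψ : H *ᵥ ψ = (E₀ : ℂ) • ψ)
    (w : ℝ → ℂ) (hw : Integrable w) (g : ℝ → ℂ)
    (hg : ∀ ω : ℝ, g ω = ∫ t : ℝ, w t * cexp (((t * ω : ℝ) : ℂ) * I))
    (hodd : ∀ ω : ℝ, g (-ω) = -g ω) :
    ∑ i, g (hH.eigenvalues i - E₀) *
          ((star ψ ⬝ᵥ (A *ᵥ ⇑(hH.eigenvectorBasis i))) *
              (star (⇑(hH.eigenvectorBasis i)) ⬝ᵥ (B *ᵥ ψ)) +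
            (star ψ ⬝ᵥ (B *ᵥ ⇑(hH.eigenvectorBasis i))) *
              (star (⇑(hH.eigenvectorBasis i)) ⬝ᵥ (A *ᵥ ψ)))
      = ∫ t : ℝ, w t *
          (star ψ ⬝ᵥ ((A * heisenbergEvolution H t B - heisenbergEvolution H t B * A) *ᵥ ψ)) := by
  rw [← filteredSpectral_identity H hH A B ψ E₀ hψ w hw g hg]
  refine Finset.sum_congr rfl fun i _ => ?_
  have : g (E₀ - hH.eigenvalues i) = -g (hH.eigenvalues i - E₀) := by
    rw [← hodd]; congr 1; ring
  rw [this]; ring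

/-- The Lorentzian time weight `w_Ω(t) = −(i/2)·sgn(t)·e^{−Ω|t|}` (value at `t = 0` immaterial; chosen
left-continuous). Theory seat memo ROTOR-THEORY-8 §116. [folklore] -/
def lorentzWeight (Ω t : ℝ) : ℂ :=
  -(I / 2) * (if 0 < t then ((Real.exp (-(Ω * t)) : ℝ) : ℂ) else -((Real.exp (Ω * t) : ℝ) : ℂ))

/-- The Lorentzian high filter `g_Ω(ω) = ω/(ω²+Ω²)` (odd; `0 ≤ g ≤ 1/(2Ω)` on `ω ≥ 0`). [folklore] -/
def lorentzFilter (Ω ω : ℝ) : ℝ := ω / (ω ^ 2 + Ω ^ 2)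

/-- The complementary low weight `ℓ_Ω(ω) = Ω²/(ω(ω²+Ω²))`. [folklore] -/
def lorentzLow (Ω ω : ℝ) : ℝ := Ω ^ 2 / (ω * (ω ^ 2 + Ω ^ 2))

/-- `g_Ω` is odd. [folklore] -/
theorem lorentzFilter_odd (Ω ω : ℝ) : lorentzFilter Ω (-ω) = -lorentzFilter Ω ω := by
  unfold lorentzFilter; rw [neg_sq, neg_div]

/-- `g_Ω ≥ 0` on `ω ≥ 0`. [folklore] -/
theorem lorentzFilter_nonneg {Ω ω : ℝ} (hω : 0 ≤ ω) : 0 ≤ lorentzFilter Ω ω := by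
  unfold lorentzFilter; positivity

/-- `1/ω = g_Ω(ω) + ℓ_Ω(ω)` for `ω ≠ 0`, `Ω ≠ 0`. [folklore] -/
theorem inv_eq_lorentzFilter_add_low {Ω ω : ℝ} (hω : ω ≠ 0) (hΩ : Ω ≠ 0) :
    1 / ω = lorentzFilter Ω ω + lorentzLow Ω ω := by
  unfold lorentzFilter lorentzLow
  have h2 : ω ^ 2 + Ω ^ 2 ≠ 0 := by positivity
  field_simp

/-- `ℓ_Ω ≥ 0` on `ω > 0`. [folklore] -/
theorem lorentzLow_nonneg {Ω ω : ℝ} (hω : 0 < ω) : 0 ≤ lorentzLow Ω ω := by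
  unfold lorentzLow; positivity

/-- The low weight is an `Ω/2`-bounded multiple of `1/ω²`: `ℓ_Ω(ω)·ω² ≤ Ω/2` (so `m^{low}(D_k) ≤ (Ω/2)·N·S(k)`). [folklore] -/
theorem lorentzLow_mul_sq_le {Ω ω : ℝ} (hΩ : 0 < Ω) (hω : 0 < ω) : lorentzLow Ω ω * ω ^ 2 ≤ Ω / 2 := by
  unfold lorentzLow
  have h2 : 0 < ω ^ 2 + Ω ^ 2 := by positivity
  rw [div_mul_eq_mul_div, div_le_div_iff₀ (by positivity) (by norm_num : (0:ℝ) < 2)]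
  nlinarith [sq_nonneg (ω - Ω), mul_pos hΩ hω, sq_nonneg ω, sq_nonneg Ω, mul_pos (mul_pos hΩ hω) hω]

/-- **(S2′)**: the Lorentzian pair is a Fourier pair, `g_Ω(ω) = ∫ w_Ω(t) e^{itω} dt` (Ω > 0).
[conjecture: theory seat hubbard-h0-rotor-theory-1, cycle 8, 2026-08-28 — memo ROTOR-THEORY-8 §116 stub (S2′); PROVED below] -/
def LorentzFilterFT : Prop :=
  ∀ Ω : ℝ, 0 < Ω → ∀ ω : ℝ,
    ((lorentzFilter Ω ω : ℝ) : ℂ) = ∫ t : ℝ, lorentzWeight Ω t * cexp (((t * ω : ℝ) : ℂ) * I)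

/-- `w_Ω(t)e^{itω}` on `t > 0`. [folklore] -/
theorem lorentzWeight_mul_cexp_of_pos (Ω ω : ℝ) {t : ℝ} (ht : 0 < t) :
    lorentzWeight Ω t * cexp (((t * ω : ℝ) : ℂ) * I) = -(I / 2) * cexp ((-(Ω : ℂ) + I * ω) * t) := by
  unfold lorentzWeight
  rw [if_pos ht, Complex.ofReal_exp, mul_assoc, ← Complex.exp_add]
  congr 2
  push_cast
  ring

/-- `w_Ω(t)e^{itω}` on `t ≤ 0`. [folklore] -/
theorem lorentzWeight_mul_cexp_of_nonpos (Ω ω : ℝ) {t : ℝ} (ht : t ≤ 0) :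
    lorentzWeight Ω t * cexp (((t * ω : ℝ) : ℂ) * I) = (I / 2) * cexp (((Ω : ℂ) + I * ω) * t) := by
  unfold lorentzWeight
  rw [if_neg (not_lt.mpr ht), Complex.ofReal_exp]
  rw [show -(I / 2) * -cexp ((Ω * t : ℝ) : ℂ) * cexp (((t * ω : ℝ) : ℂ) * I)
      = (I / 2) * (cexp ((Ω * t : ℝ) : ℂ) * cexp (((t * ω : ℝ) : ℂ) * I)) by ring, ← Complex.exp_add]
  congr 2
  push_cast
  ring

/-- Integrability on `(0,∞)`. [folklore] -/
theorem integrableOn_lorentz_Ioi {Ω : ℝ} (hΩ : 0 < Ω) (ω : ℝ) :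
    IntegrableOn (fun t : ℝ => lorentzWeight Ω t * cexp (((t * ω : ℝ) : ℂ) * I)) (Set.Ioi 0) := by
  have ha : (-(Ω : ℂ) + I * ω).re < 0 := by simp [hΩ]
  have h1 : IntegrableOn (fun t : ℝ => -(I / 2) * cexp ((-(Ω : ℂ) + I * ω) * t)) (Set.Ioi 0) :=
    (integrableOn_exp_mul_complex_Ioi ha 0).const_mul _
  exact h1.congr_fun (fun t ht => (lorentzWeight_mul_cexp_of_pos Ω ω ht).symm) measurableSet_Ioi

/-- Integrability on `(−∞,0]`. [folklore] -/
theorem integrableOn_lorentz_Iic {Ω : ℝ} (hΩ : 0 < Ω) (ω : ℝ) :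
    IntegrableOn (fun t : ℝ => lorentzWeight Ω t * cexp (((t * ω : ℝ) : ℂ) * I)) (Set.Iic 0) := by
  have ha : 0 < ((Ω : ℂ) + I * ω).re := by simp [hΩ]
  have h1 : IntegrableOn (fun t : ℝ => (I / 2) * cexp (((Ω : ℂ) + I * ω) * t)) (Set.Iic 0) :=
    (integrableOn_exp_mul_complex_Iic ha 0).const_mul _
  exact h1.congr_fun (fun t ht => (lorentzWeight_mul_cexp_of_nonpos Ω ω ht).symm) measurableSet_Iic

/-- `w_Ω` is integrable (`Ω > 0`). [folklore] -/
theorem integrable_lorentzWeight {Ω : ℝ} (hΩ : 0 < Ω) : Integrable (lorentzWeight Ω) := by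
  have h := (integrableOn_lorentz_Iic hΩ 0).union (integrableOn_lorentz_Ioi hΩ 0)
  rw [Set.Iic_union_Ioi, integrableOn_univ] at h
  refine h.congr (Filter.Eventually.of_forall fun t => ?_)
  show lorentzWeight Ω t * cexp (((t * 0 : ℝ) : ℂ) * I) = lorentzWeight Ω t
  simp

/-- **(S2′) PROVED**: `∫ w_Ω(t) e^{itω} dt = ω/(ω² + Ω²)`. [folklore] -/
theorem lorentzFilterFT_holds : LorentzFilterFT := by
  intro Ω hΩ ω
  rw [← intervalIntegral.integral_Iic_add_Ioi (integrableOn_lorentz_Iic hΩ ω) (integrableOn_lorentz_Ioi hΩ ω)]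
  have ha₁ : 0 < ((Ω : ℂ) + I * ω).re := by simp [hΩ]
  have ha₂ : (-(Ω : ℂ) + I * ω).re < 0 := by simp [hΩ]
  rw [setIntegral_congr_fun measurableSet_Iic (fun t ht => lorentzWeight_mul_cexp_of_nonpos Ω ω ht),
    setIntegral_congr_fun measurableSet_Ioi (fun t ht => lorentzWeight_mul_cexp_of_pos Ω ω ht),
    integral_const_mul, integral_const_mul,
    integral_exp_mul_complex_Iic ha₁, integral_exp_mul_complex_Ioi ha₂]
  have h₁ : (Ω : ℂ) + I * ω ≠ 0 := fun h => by simpa [hΩ.ne'] using congrArg Complex.re h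
  have h₂ : -(Ω : ℂ) + I * ω ≠ 0 := fun h => by simpa [hΩ.ne'] using congrArg Complex.re h
  have h₃ : ((ω : ℂ) ^ 2 + (Ω : ℂ) ^ 2) ≠ 0 := by
    norm_cast
    positivity
  unfold lorentzFilter
  simp only [Complex.ofReal_zero, mul_zero, Complex.exp_zero]
  push_cast
  have h₁' : (Ω : ℂ) + ω * I ≠ 0 := by simpa [mul_comm] using h₁
  have h₂' : -(Ω : ℂ) + ω * I ≠ 0 := by simpa [mul_comm] using h₂
  field_simp
  linear_combination (-2 * (ω : ℂ) * (Ω : ℂ) ^ 2) * Complex.I_sq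


end Summit.HubbardSuperconductivity.HubbardSuperconductivity.Theorems.AnisotropyChord.Stiffness
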